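import Mathlib.Analysis.SpecialFunctions.Trigonometric.Deriv
import Mathlib.Analysis.SpecialFunctions.Log.Deriv
import Mathlib.Analysis.SpecialFunctions.Trigonometric.Bounds
import HarnessLib

/-!
# The fundamental solutions of the angular operator of Elgindi's polar elliptic problem
([Elgindi2021] §7.1, the angular operator of (PolarBSL); §8.3 Proposition 8.13, "we do this by
directly solving the above equation")

Topic `Literature/Analysis/FluidPDE`. Support file (definitions with bodies and proved theorems, no
named facts) on the proof path of the named fact
`Literature.Analysis.FluidPDE.Elgindi.ElgindiGhoulMasmoudi2021_stabilityCore`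
(`ElgindiStabilityDecomposition.lean`). T. M. Elgindi, Ann. of Math. 194 (2021) =
arXiv:1904.04795, §7 (p. 19): the polar elliptic operator
`L_α = −α²R²∂_RR − α(5+α)R∂_R − ∂_θθ + ∂_θ(tan θ ·) − 6` and its angular part
`L_θ = −∂_θθ + ∂_θ(tan θ ·) − 6` ("`sin(2θ)` is in the kernel of `L`" at `α = 0`); §8.3
Proposition 8.13 (p. 27), where the angular problem is solved by quadratures.

**The factorisation.** For `Φ = cos θ·χ` one has `L_θΦ = cos θ·Mχ`,
`Mχ = −χ″ + 3 tan θ χ′ − 4χ = cos⁻³θ·(−(cos³θ χ′)′ − 4cos³θ χ)`, a Sturm–Liouville operator with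
`p = cos³θ`. This file provides the two fundamental solutions of `Mu = 0` in closed form,
`u₁ = sin θ` (i.e. `Φ = sin θ cos θ = ½ sin 2θ`, the kernel of `L_θ`) and
`u₂ = ½tan²θ + (3/2) sin θ·log((1 + sin θ)/cos θ) − 1`, through the **bounded kernel**
`k₂ = u₂cos²θ` (`greenK2`) and the **flux** `v₂ = cos³θ·u₂′` (`greenV2`): `u₂ = k₂/cos²θ`
(`greenU2`), `u₂′ = v₂/cos³θ` (`hasDerivAt_greenU2`), the homogeneous equation in flux form
`v₂′ = −4cos θ·k₂ (= −4cos³θ·u₂)` (`hasDerivAt_greenV2`), the **Wronskian identity**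
`cos⁴θ·k₂ − v₂·sin θ cos²θ = −cos²θ` (i.e. `cos³θ(u₁u₂′ − u₁′u₂) = 1`, `greenK2_wronskian`), and the
bounds `|k₂| ≤ 5`, `|v₂| ≤ 6` on `[0, π/2)` used by the Green's operator of the angular problem.
Here `log((1 + sin θ)/cos θ) = log(sec θ + tan θ)` has derivative `sec θ` (`hasDerivAt_secTanLog`).
-/

noncomputable section

open Set Real Filter
open _root_.Topology

namespace Literature.Analysis.FluidPDE

namespace Elgindi

/-! ### `log(sec θ + tan θ)` -/

/-- `L(θ) = log((1 + sin θ)/cos θ) = log(sec θ + tan θ)`, the primitive of `sec θ`. [folklore] -/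
def secTanLog (θ : ℝ) : ℝ := Real.log ((1 + Real.sin θ) / Real.cos θ)

/-- On `(−π/2, π/2)`, `−1 < sin θ`. [folklore] -/
theorem neg_one_lt_sin_of_mem {θ : ℝ} (hθ : θ ∈ Ioo (-(π / 2)) (π / 2)) : -1 < Real.sin θ := by
  have h := Real.sin_lt_sin_of_lt_of_le_pi_div_two (le_refl _) hθ.2.le hθ.1
  rwa [Real.sin_neg, Real.sin_pi_div_two] at h

/-- On `(−π/2, π/2)` the argument `(1 + sin θ)/cos θ` is positive. [folklore] -/
theorem secTanLog_arg_pos {θ : ℝ} (hθ : θ ∈ Ioo (-(π / 2)) (π / 2)) : 0 < (1 + Real.sin θ) / Real.cos θ := by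
  have hc : 0 < Real.cos θ := Real.cos_pos_of_mem_Ioo hθ
  have hs := neg_one_lt_sin_of_mem hθ
  exact div_pos (by linarith) hc

/-- **`(log(sec θ + tan θ))′ = sec θ`** on `(−π/2, π/2)`. [folklore] -/
theorem hasDerivAt_secTanLog {θ : ℝ} (hθ : θ ∈ Ioo (-(π / 2)) (π / 2)) :
    HasDerivAt secTanLog (1 / Real.cos θ) θ := by
  have hc : 0 < Real.cos θ := Real.cos_pos_of_mem_Ioo hθ
  have hs := neg_one_lt_sin_of_mem hθ
  have harg := secTanLog_arg_pos hθ
  have hs2 : Real.sin θ ^ 2 + Real.cos θ ^ 2 = 1 := Real.sin_sq_add_cos_sq θ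
  have hf : HasDerivAt (fun θ' => (1 + Real.sin θ') / Real.cos θ')
      ((Real.cos θ * Real.cos θ - (1 + Real.sin θ) * (-Real.sin θ)) / Real.cos θ ^ 2) θ :=
    ((Real.hasDerivAt_sin θ).const_add 1).fun_div (Real.hasDerivAt_cos θ) hc.ne'
  have key : Real.cos θ * Real.cos θ - (1 + Real.sin θ) * (-Real.sin θ) = 1 + Real.sin θ := by
    linear_combination hs2
  rw [key] at hf
  have hlog := hf.log harg.ne'
  unfold secTanLog
  refine hlog.congr_deriv ?_
  have h1 : (1 + Real.sin θ) ≠ 0 := by linarith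
  field_simp

/-- `0 ≤ L(θ)` on `[0, π/2)`: the argument is `≥ 1`. [folklore] -/
theorem secTanLog_nonneg {θ : ℝ} (hθ : θ ∈ Ico 0 (π / 2)) : 0 ≤ secTanLog θ := by
  have hc : 0 < Real.cos θ := Real.cos_pos_of_mem_Ioo ⟨by linarith [hθ.1, Real.pi_pos], hθ.2⟩
  have hs : 0 ≤ Real.sin θ := Real.sin_nonneg_of_nonneg_of_le_pi hθ.1 (by linarith [hθ.2, Real.pi_pos])
  have hc1 : Real.cos θ ≤ 1 := Real.cos_le_one θ
  unfold secTanLog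
  refine Real.log_nonneg ?_
  rw [le_div_iff₀ hc]; linarith

/-- `cos θ·L(θ) ≤ 2` on `[0, π/2)` (`log y ≤ y`, `(1 + sin θ)/cos θ ≤ 2/cos θ`). [folklore] -/
theorem cos_mul_secTanLog_le {θ : ℝ} (hθ : θ ∈ Ico 0 (π / 2)) : Real.cos θ * secTanLog θ ≤ 2 := by
  have hθ' : θ ∈ Ioo (-(π / 2)) (π / 2) := ⟨by linarith [hθ.1, Real.pi_pos], hθ.2⟩
  have hc : 0 < Real.cos θ := Real.cos_pos_of_mem_Ioo hθ'
  have harg := secTanLog_arg_pos hθ'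
  have hlog : secTanLog θ ≤ (1 + Real.sin θ) / Real.cos θ := by
    unfold secTanLog
    have := Real.log_le_sub_one_of_pos harg
    linarith
  have hs1 : Real.sin θ ≤ 1 := Real.sin_le_one θ
  calc Real.cos θ * secTanLog θ ≤ Real.cos θ * ((1 + Real.sin θ) / Real.cos θ) := mul_le_mul_of_nonneg_left hlog hc.le
    _ = 1 + Real.sin θ := by field_simp
    _ ≤ 2 := by linarith

/-! ### The bounded kernel `k₂ = u₂cos²θ`, the flux `v₂ = cos³θ·u₂′`, and `u₂` -/

/-- **`k₂ = u₂cos²θ = ½sin²θ + (3/2) sin θ cos²θ·L − cos²θ`**, with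
`u₂ = ½tan²θ + (3/2) sin θ·L − 1` the second solution of `−u″ + 3 tan θ u′ − 4u = 0`. [cite: Elgindi2021, §8.3 proof of Proposition 8.13 (p. 27 of arXiv:1904.04795): the angular equation solved by quadratures] -/
def greenK2 (θ : ℝ) : ℝ := Real.sin θ ^ 2 / 2 + 3 / 2 * Real.sin θ * Real.cos θ ^ 2 * secTanLog θ - Real.cos θ ^ 2

/-- **The flux `v₂ = cos³θ·u₂′ = sin θ + (3/2)cos⁴θ·L + (3/2) sin θ cos²θ`.** [folklore] -/
def greenV2 (θ : ℝ) : ℝ := Real.sin θ + 3 / 2 * Real.cos θ ^ 4 * secTanLog θ + 3 / 2 * Real.sin θ * Real.cos θ ^ 2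

/-- **The second fundamental solution `u₂ = k₂/cos²θ`** of `−u″ + 3 tan θ u′ − 4u = 0`. [folklore] -/
def greenU2 (θ : ℝ) : ℝ := greenK2 θ / Real.cos θ ^ 2

/-- `cos⁴θ·L` has derivative `−4cos³θ sin θ·L + cos³θ` on `(−π/2, π/2)`. [folklore] -/
theorem hasDerivAt_cos_pow_four_mul_secTanLog {θ : ℝ} (hθ : θ ∈ Ioo (-(π / 2)) (π / 2)) :
    HasDerivAt (fun θ' => Real.cos θ' ^ 4 * secTanLog θ') (-4 * Real.cos θ ^ 3 * Real.sin θ * secTanLog θ + Real.cos θ ^ 3) θ := by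
  have hc : Real.cos θ ≠ 0 := (Real.cos_pos_of_mem_Ioo hθ).ne'
  have h := ((Real.hasDerivAt_cos θ).fun_pow 4).fun_mul (hasDerivAt_secTanLog hθ)
  refine h.congr_deriv ?_
  field_simp
  push_cast
  ring

/-- `sin θ cos²θ·L` has derivative `cos³θ·L − 2sin²θ cos θ·L + sin θ cos θ` on `(−π/2, π/2)`. [folklore] -/
theorem hasDerivAt_sin_mul_cos_sq_mul_secTanLog {θ : ℝ} (hθ : θ ∈ Ioo (-(π / 2)) (π / 2)) :
    HasDerivAt (fun θ' => Real.sin θ' * Real.cos θ' ^ 2 * secTanLog θ')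
      (Real.cos θ ^ 3 * secTanLog θ - 2 * Real.sin θ ^ 2 * Real.cos θ * secTanLog θ + Real.sin θ * Real.cos θ) θ := by
  have hc : Real.cos θ ≠ 0 := (Real.cos_pos_of_mem_Ioo hθ).ne'
  have h := (((Real.hasDerivAt_sin θ).fun_mul ((Real.hasDerivAt_cos θ).fun_pow 2))).fun_mul (hasDerivAt_secTanLog hθ)
  refine h.congr_deriv ?_
  field_simp
  push_cast
  ring

/-- **`k₂′ = (9/2) sin θ cos θ + (3/2)cos³θ·L − 3 sin²θ cos θ·L`** on `(−π/2, π/2)`. [folklore] -/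
theorem hasDerivAt_greenK2 {θ : ℝ} (hθ : θ ∈ Ioo (-(π / 2)) (π / 2)) :
    HasDerivAt greenK2 (9 / 2 * Real.sin θ * Real.cos θ + 3 / 2 * Real.cos θ ^ 3 * secTanLog θ
      - 3 * Real.sin θ ^ 2 * Real.cos θ * secTanLog θ) θ := by
  have hs := Real.hasDerivAt_sin θ
  have hcos := Real.hasDerivAt_cos θ
  have h1 : HasDerivAt (fun θ' => Real.sin θ' ^ 2 / 2) (((2 : ℕ) : ℝ) * Real.sin θ ^ (2 - 1) * Real.cos θ / 2) θ := (hs.fun_pow 2).div_const 2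
  have h2 : HasDerivAt (fun θ' => 3 / 2 * (Real.sin θ' * Real.cos θ' ^ 2 * secTanLog θ'))
      (3 / 2 * (Real.cos θ ^ 3 * secTanLog θ - 2 * Real.sin θ ^ 2 * Real.cos θ * secTanLog θ + Real.sin θ * Real.cos θ)) θ :=
    (hasDerivAt_sin_mul_cos_sq_mul_secTanLog hθ).const_mul (3 / 2)
  have h3 : HasDerivAt (fun θ' => Real.cos θ' ^ 2) (((2 : ℕ) : ℝ) * Real.cos θ ^ (2 - 1) * (-Real.sin θ)) θ := hcos.fun_pow 2
  have h := (h1.fun_add h2).fun_sub h3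
  have e : greenK2 = fun θ' => Real.sin θ' ^ 2 / 2 + 3 / 2 * (Real.sin θ' * Real.cos θ' ^ 2 * secTanLog θ') - Real.cos θ' ^ 2 := by
    funext θ'; simp only [greenK2]; ring
  rw [e]
  refine h.congr_deriv ?_
  push_cast
  ring

/-- **The homogeneous equation in flux form: `v₂′ = −4cos θ·k₂ (= −4cos³θ·u₂)`** on
`(−π/2, π/2)`, i.e. `−(cos³θ u₂′)′ − 4cos³θ u₂ = 0`. [cite: Elgindi2021, §7.1 / §8.3 (pp. 19, 27 of arXiv:1904.04795): the angular operator and its kernel] -/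
theorem hasDerivAt_greenV2 {θ : ℝ} (hθ : θ ∈ Ioo (-(π / 2)) (π / 2)) :
    HasDerivAt greenV2 (-4 * Real.cos θ * greenK2 θ) θ := by
  have hs := Real.hasDerivAt_sin θ
  have hcos := Real.hasDerivAt_cos θ
  have hs2 : Real.sin θ ^ 2 + Real.cos θ ^ 2 = 1 := Real.sin_sq_add_cos_sq θ
  have h1 : HasDerivAt (fun θ' => 3 / 2 * (Real.cos θ' ^ 4 * secTanLog θ'))
      (3 / 2 * (-4 * Real.cos θ ^ 3 * Real.sin θ * secTanLog θ + Real.cos θ ^ 3)) θ :=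
    (hasDerivAt_cos_pow_four_mul_secTanLog hθ).const_mul (3 / 2)
  have h2 : HasDerivAt (fun θ' => 3 / 2 * (Real.sin θ' * Real.cos θ' ^ 2))
      (3 / 2 * (Real.cos θ * Real.cos θ ^ 2 + Real.sin θ * (((2 : ℕ) : ℝ) * Real.cos θ ^ (2 - 1) * (-Real.sin θ)))) θ :=
    (hs.fun_mul (hcos.fun_pow 2)).const_mul (3 / 2)
  have h := (hs.fun_add h1).fun_add h2
  have e : greenV2 = fun θ' => Real.sin θ' + 3 / 2 * (Real.cos θ' ^ 4 * secTanLog θ') + 3 / 2 * (Real.sin θ' * Real.cos θ' ^ 2) := by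
    funext θ'; simp only [greenV2]; ring
  rw [e]
  refine h.congr_deriv ?_
  unfold greenK2
  push_cast
  linear_combination (-Real.cos θ) * hs2

/-- **The Wronskian identity `cos⁴θ·k₂ − v₂·sin θ cos²θ = −cos²θ`** (equivalently
`cos³θ(u₁u₂′ − u₁′u₂) = 1` with `u₁ = sin θ`): the jump of the Green's function. [folklore] -/
theorem greenK2_wronskian (θ : ℝ) :
    Real.cos θ ^ 4 * greenK2 θ - greenV2 θ * (Real.sin θ * Real.cos θ ^ 2) = -Real.cos θ ^ 2 := by
  have hs2 : Real.sin θ ^ 2 + Real.cos θ ^ 2 = 1 := Real.sin_sq_add_cos_sq θ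
  unfold greenK2 greenV2
  linear_combination (-(Real.cos θ ^ 2 * (1 + Real.cos θ ^ 2))) * hs2

/-- **The cancellation `cos θ·k₂′ = v₂ − 2 sin θ·k₂`** (`k₂ = u₂cos²θ`, `v₂ = cos³θu₂′`). [folklore] -/
theorem cos_mul_deriv_greenK2 (θ : ℝ) :
    Real.cos θ * (9 / 2 * Real.sin θ * Real.cos θ + 3 / 2 * Real.cos θ ^ 3 * secTanLog θ
      - 3 * Real.sin θ ^ 2 * Real.cos θ * secTanLog θ) = greenV2 θ - 2 * Real.sin θ * greenK2 θ := by
  have hs2 : Real.sin θ ^ 2 + Real.cos θ ^ 2 = 1 := Real.sin_sq_add_cos_sq θ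
  unfold greenK2 greenV2
  linear_combination (Real.sin θ) * hs2

/-- **`u₂′ = v₂/cos³θ`** on `(−π/2, π/2)`. [folklore] -/
theorem hasDerivAt_greenU2 {θ : ℝ} (hθ : θ ∈ Ioo (-(π / 2)) (π / 2)) :
    HasDerivAt greenU2 (greenV2 θ / Real.cos θ ^ 3) θ := by
  have hc : Real.cos θ ≠ 0 := (Real.cos_pos_of_mem_Ioo hθ).ne'
  have hk := hasDerivAt_greenK2 hθ
  have hc2 : HasDerivAt (fun θ' => Real.cos θ' ^ 2) (((2 : ℕ) : ℝ) * Real.cos θ ^ (2 - 1) * (-Real.sin θ)) θ := (Real.hasDerivAt_cos θ).fun_pow 2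
  have h := hk.fun_div hc2 (pow_ne_zero 2 hc)
  unfold greenU2
  refine h.congr_deriv ?_
  have key := cos_mul_deriv_greenK2 θ
  have e1 : (9 / 2 * Real.sin θ * Real.cos θ + 3 / 2 * Real.cos θ ^ 3 * secTanLog θ - 3 * Real.sin θ ^ 2 * Real.cos θ * secTanLog θ) * Real.cos θ ^ 2
      - greenK2 θ * (((2 : ℕ) : ℝ) * Real.cos θ ^ (2 - 1) * -Real.sin θ) = Real.cos θ * greenV2 θ := by
    push_cast
    linear_combination (Real.cos θ) * key
  rw [e1]
  field_simp

/-- `k₂ = u₂cos²θ` where `cos θ ≠ 0`. [folklore] -/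
theorem greenU2_mul_cos_sq {θ : ℝ} (hc : Real.cos θ ≠ 0) : greenU2 θ * Real.cos θ ^ 2 = greenK2 θ := by
  unfold greenU2; field_simp

/-! ### Continuity -/

/-- `L` is continuous on `(−π/2, π/2)`. [folklore] -/
theorem continuousOn_secTanLog : ContinuousOn secTanLog (Ioo (-(π / 2)) (π / 2)) :=
  fun _ hθ => (hasDerivAt_secTanLog hθ).continuousAt.continuousWithinAt

/-- `k₂` is continuous on `(−π/2, π/2)`. [folklore] -/
theorem continuousOn_greenK2 : ContinuousOn greenK2 (Ioo (-(π / 2)) (π / 2)) :=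
  fun _ hθ => (hasDerivAt_greenK2 hθ).continuousAt.continuousWithinAt

/-- `v₂` is continuous on `(−π/2, π/2)`. [folklore] -/
theorem continuousOn_greenV2 : ContinuousOn greenV2 (Ioo (-(π / 2)) (π / 2)) :=
  fun _ hθ => (hasDerivAt_greenV2 hθ).continuousAt.continuousWithinAt

/-- `u₂` is continuous on `(−π/2, π/2)`. [folklore] -/
theorem continuousOn_greenU2 : ContinuousOn greenU2 (Ioo (-(π / 2)) (π / 2)) :=
  fun _ hθ => (hasDerivAt_greenU2 hθ).continuousAt.continuousWithinAt

/-! ### Continuity of `k₂` up to `θ = π/2` -/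

/-- `0 ≤ cos²θ·L ≤ 2cos θ` on `[0, π/2]` (at `π/2` both sides vanish). [folklore] -/
theorem cos_sq_mul_secTanLog_mem {θ : ℝ} (hθ : θ ∈ Icc 0 (π / 2)) :
    0 ≤ Real.cos θ ^ 2 * secTanLog θ ∧ Real.cos θ ^ 2 * secTanLog θ ≤ 2 * Real.cos θ := by
  rcases eq_or_lt_of_le hθ.2 with h | h
  · rw [h, Real.cos_pi_div_two]; simp
  · have hθ' : θ ∈ Ico 0 (π / 2) := ⟨hθ.1, h⟩
    have hc0 : 0 < Real.cos θ := Real.cos_pos_of_mem_Ioo ⟨by linarith [hθ.1, Real.pi_pos], h⟩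
    have hL0 := secTanLog_nonneg hθ'
    have hL2 := cos_mul_secTanLog_le hθ'
    refine ⟨by positivity, ?_⟩
    have : Real.cos θ ^ 2 * secTanLog θ = Real.cos θ * (Real.cos θ * secTanLog θ) := by ring
    rw [this]
    nlinarith

/-- `k₂(π/2) = 1/2`. [folklore] -/
theorem greenK2_pi_div_two : greenK2 (π / 2) = 1 / 2 := by
  simp [greenK2, Real.cos_pi_div_two, Real.sin_pi_div_two]

/-- **`k₂` is continuous on the closed interval `[0, π/2]`** (`cos²θ·L → 0`). [folklore] -/
theorem continuousOn_greenK2_Icc : ContinuousOn greenK2 (Icc 0 (π / 2)) := by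
  -- `g = cos²θ·L` is continuous within `[0, π/2]` at every point
  have hg : ∀ θ ∈ Icc (0:ℝ) (π / 2), ContinuousWithinAt (fun θ' => Real.cos θ' ^ 2 * secTanLog θ') (Icc 0 (π / 2)) θ := by
    intro θ hθ
    rcases eq_or_lt_of_le hθ.2 with h | h
    · -- at `π/2`: squeeze between `0` and `2cos θ`
      subst h
      have hval : Real.cos (π / 2) ^ 2 * secTanLog (π / 2) = 0 := by rw [Real.cos_pi_div_two]; simp
      rw [ContinuousWithinAt, hval]
      have hup : Tendsto (fun θ' : ℝ => 2 * Real.cos θ') (𝓝[Icc 0 (π / 2)] (π / 2)) (𝓝 0) := by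
        have : Tendsto (fun θ' : ℝ => 2 * Real.cos θ') (𝓝 (π / 2)) (𝓝 (2 * Real.cos (π / 2))) :=
          ((Real.continuous_cos.const_mul 2).tendsto _)
        rw [Real.cos_pi_div_two, mul_zero] at this
        exact this.mono_left nhdsWithin_le_nhds
      refine tendsto_of_tendsto_of_tendsto_of_le_of_le' tendsto_const_nhds hup ?_ ?_
      · exact eventually_nhdsWithin_of_forall fun θ' hθ' => (cos_sq_mul_secTanLog_mem hθ').1
      · exact eventually_nhdsWithin_of_forall fun θ' hθ' => (cos_sq_mul_secTanLog_mem hθ').2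
    · have hθ' : θ ∈ Ioo (-(π / 2)) (π / 2) := ⟨by linarith [hθ.1, Real.pi_pos], h⟩
      have h1 : ContinuousAt secTanLog θ := (hasDerivAt_secTanLog hθ').continuousAt
      exact ((Real.continuous_cos.continuousAt.pow 2).mul h1).continuousWithinAt
  intro θ hθ
  have h2 : ContinuousWithinAt (fun θ' => Real.sin θ' ^ 2 / 2 + 3 / 2 * Real.sin θ' * (Real.cos θ' ^ 2 * secTanLog θ') - Real.cos θ' ^ 2) (Icc 0 (π / 2)) θ := by
    have hs : ContinuousWithinAt (fun θ' => Real.sin θ') (Icc 0 (π / 2)) θ := Real.continuous_sin.continuousWithinAt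
    have hc : ContinuousWithinAt (fun θ' => Real.cos θ') (Icc 0 (π / 2)) θ := Real.continuous_cos.continuousWithinAt
    exact (((hs.pow 2).div_const 2).add ((hs.const_mul (3 / 2)).mul (hg θ hθ))).sub (hc.pow 2)
  refine h2.congr (fun θ' _ => ?_) ?_
  · simp only [greenK2]; ring
  · simp only [greenK2]; ring

/-! ### Bounds on `[0, π/2)` and values at `0` -/

/-- **`|k₂| ≤ 5` on `[0, π/2)`.** [folklore] -/
theorem abs_greenK2_le {θ : ℝ} (hθ : θ ∈ Ico 0 (π / 2)) : |greenK2 θ| ≤ 5 := by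
  have hc0 : 0 < Real.cos θ := Real.cos_pos_of_mem_Ioo ⟨by linarith [hθ.1, Real.pi_pos], hθ.2⟩
  have hc1 : Real.cos θ ≤ 1 := Real.cos_le_one θ
  have hs0 : 0 ≤ Real.sin θ := Real.sin_nonneg_of_nonneg_of_le_pi hθ.1 (by linarith [hθ.2, Real.pi_pos])
  have hs1 : Real.sin θ ≤ 1 := Real.sin_le_one θ
  have hL0 := secTanLog_nonneg hθ
  have hL2 := cos_mul_secTanLog_le hθ
  have hcL : 0 ≤ Real.cos θ * secTanLog θ := mul_nonneg hc0.le hL0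
  have hsc : Real.sin θ * Real.cos θ ≤ 1 := by nlinarith
  have hsc0 : 0 ≤ Real.sin θ * Real.cos θ := mul_nonneg hs0 hc0.le
  have hP : Real.sin θ * Real.cos θ ^ 2 * secTanLog θ ≤ 2 := by
    have e : Real.sin θ * Real.cos θ ^ 2 * secTanLog θ = (Real.sin θ * Real.cos θ) * (Real.cos θ * secTanLog θ) := by ring
    rw [e]
    calc (Real.sin θ * Real.cos θ) * (Real.cos θ * secTanLog θ) ≤ 1 * 2 := mul_le_mul hsc hL2 hcL (by norm_num)
      _ = 2 := by norm_num
  have hP0 : 0 ≤ Real.sin θ * Real.cos θ ^ 2 * secTanLog θ := by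
    have e : Real.sin θ * Real.cos θ ^ 2 * secTanLog θ = (Real.sin θ * Real.cos θ) * (Real.cos θ * secTanLog θ) := by ring
    rw [e]; exact mul_nonneg hsc0 hcL
  unfold greenK2
  rw [abs_le]
  constructor
  · nlinarith [sq_nonneg (Real.sin θ), sq_nonneg (Real.cos θ)]
  · nlinarith [sq_nonneg (Real.sin θ), sq_nonneg (Real.cos θ)]

/-- **`|v₂| ≤ 6` on `[0, π/2)`.** [folklore] -/
theorem abs_greenV2_le {θ : ℝ} (hθ : θ ∈ Ico 0 (π / 2)) : |greenV2 θ| ≤ 6 := by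
  have hc0 : 0 < Real.cos θ := Real.cos_pos_of_mem_Ioo ⟨by linarith [hθ.1, Real.pi_pos], hθ.2⟩
  have hc1 : Real.cos θ ≤ 1 := Real.cos_le_one θ
  have hs0 : 0 ≤ Real.sin θ := Real.sin_nonneg_of_nonneg_of_le_pi hθ.1 (by linarith [hθ.2, Real.pi_pos])
  have hs1 : Real.sin θ ≤ 1 := Real.sin_le_one θ
  have hL0 := secTanLog_nonneg hθ
  have hL2 := cos_mul_secTanLog_le hθ
  have hcL : 0 ≤ Real.cos θ * secTanLog θ := mul_nonneg hc0.le hL0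
  have hc3 : Real.cos θ ^ 3 ≤ 1 := pow_le_one₀ hc0.le hc1
  have hc30 : 0 ≤ Real.cos θ ^ 3 := pow_nonneg hc0.le 3
  have h4 : Real.cos θ ^ 4 * secTanLog θ ≤ 2 := by
    have : Real.cos θ ^ 4 * secTanLog θ = Real.cos θ ^ 3 * (Real.cos θ * secTanLog θ) := by ring
    rw [this]
    calc Real.cos θ ^ 3 * (Real.cos θ * secTanLog θ) ≤ 1 * 2 := mul_le_mul hc3 hL2 hcL (by norm_num)
      _ = 2 := by norm_num
  have h40 : 0 ≤ Real.cos θ ^ 4 * secTanLog θ := by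
    have : Real.cos θ ^ 4 * secTanLog θ = Real.cos θ ^ 3 * (Real.cos θ * secTanLog θ) := by ring
    rw [this]; exact mul_nonneg hc30 hcL
  have h5 : Real.sin θ * Real.cos θ ^ 2 ≤ 1 := by nlinarith [sq_nonneg (Real.cos θ)]
  have h50 : 0 ≤ Real.sin θ * Real.cos θ ^ 2 := mul_nonneg hs0 (sq_nonneg _)
  unfold greenV2
  rw [abs_le]
  constructor
  · nlinarith
  · nlinarith

/-- **`|u₂|cos²θ ≤ 5`** on `[0, π/2)`. [folklore] -/
theorem abs_greenU2_mul_cos_sq_le {θ : ℝ} (hθ : θ ∈ Ico 0 (π / 2)) : |greenU2 θ| * Real.cos θ ^ 2 ≤ 5 := by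
  have hc : Real.cos θ ≠ 0 := (Real.cos_pos_of_mem_Ioo ⟨by linarith [hθ.1, Real.pi_pos], hθ.2⟩).ne'
  have h := abs_greenK2_le hθ
  rw [← greenU2_mul_cos_sq hc, abs_mul, abs_of_nonneg (sq_nonneg (Real.cos θ))] at h
  exact h

/-- `L(0) = 0`. [folklore] -/
@[simp] theorem secTanLog_zero : secTanLog 0 = 0 := by
  simp [secTanLog]

/-- `k₂(0) = −1`. [folklore] -/
theorem greenK2_zero : greenK2 0 = -1 := by
  simp [greenK2]

/-- `v₂(0) = 0`. [folklore] -/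
theorem greenV2_zero : greenV2 0 = 0 := by
  simp [greenV2]

/-- `u₂(0) = −1`. [folklore] -/
theorem greenU2_zero : greenU2 0 = -1 := by
  simp [greenU2, greenK2_zero]

end Elgindi

end Literature.Analysis.FluidPDE
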